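import Mathlib
import Summits.RiemannHypothesis.RiemannHypothesis.Theorems.WeilFarFloorCoshResidual
import Summits.RiemannHypothesis.RiemannHypothesis.Theorems.WeilFarFloorSmoothProfile
import Summits.RiemannHypothesis.RiemannHypothesis.Theorems.WeilFarFloorResidualArch
import HarnessLib

/-!
# A smooth second direction for the floor gap: the box-then-bump smoothing of the truncated cosh residual (RH-free)

Helper file (`--supports stmt-RiemannHypothesis-0098`, lead-track anchor: Weil-positivity window ladder, format-C far bound),
pure proofs.  Seat rh-explicit-weil-1 gen15 (memo `run/shared/lean/pub/rh-explicit/rh-explicit-weil-1/FORMAT-K3.md` §16.4).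

For the LOWER half of the second-order law the test direction must be a real Weil test `v` supported in `[−a, a]`, `L²`-close to the
residual `r = 1_{[−a,a]}(T_aC_a − R_cC_a)`, with an explicit QUADRATIC modulus `D_h(v) ≤ M h²` (the zero-energy bound
`WeilFarFloorZeroEnergyMoments` needs it).  Construction: truncate (`r̃ = 1_{[−(a−2σ), a−2σ]}(T_aC_a − R C_a)`), average over a box of
half-width `σ` (`w = ψ_σ ⋆ r̃`, `ψ_σ = (2σ)⁻¹1_{[−σ,σ]}`), then mollify with the bump of scale `σ` (`v = φ_σ ⋆ w`,
`FloorSmoothing`).  The box stage gives the quadratic modulus: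

  `w(x+h) − w(x) = (h/2σ)·(A₁(x) − A₂(x))`, `A_i` averages of `r̃` over windows of length `h` (`0 < h ≤ 2σ`), so
  `D_h(w) ≤ (h/σ)²‖r̃‖²` (`integral_sq_boxSmoothed_shift_sub_le`), and the bump stage contracts increments.

★ `exists_smoothedResidual`: for `0 < σ` and any real `R` there is a real Weil test `v` with `tsupport v ⊆ [−a, a]`,
admissible with `|v| ≤ (2A + |R|)cosh(a/2)`, `∫v² ≤ ∫r̃²`, `D_h(v) ≤ (h/σ)²∫r̃²` for `0 < h ≤ 2σ`, and
`∫(v − r̃)² ≤ 4δ` whenever `∫(r̃(x−y) − r̃(x))² ≤ δ` for all `|y| ≤ σ`.  Standard axioms only.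
-/

set_option linter.dupNamespace false
set_option autoImplicit false

noncomputable section

open MeasureTheory Set Filter
open scoped Real Topology ArithmeticFunction.vonMangoldt

namespace Summit.RiemannHypothesis.RiemannHypothesis.Theorems.WeilFormatC

namespace FloorSecondOrder

open Literature.NumberTheory.LFunctions FloorCosh FloorCoshSplit FloorSmoothing

/-! ## §1 Box weights -/

/-- The normalised box weight `(1/ℓ)·1_S` of a measurable set `S ⊆ [−ε, ε]` of volume `ℓ > 0`: measurable, nonnegative,
bounded by `1/ℓ`, vanishing off `[−ε, ε]`, with integral one. -/
theorem box_weight {S : Set ℝ} {ε ℓ : ℝ} (hS : MeasurableSet S) (hSε : S ⊆ Icc (-ε) ε) (hℓ : 0 < ℓ)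
    (hvol : volume.real S = ℓ) :
    Measurable (fun y ↦ (1 / ℓ) * S.indicator (fun _ ↦ (1 : ℝ)) y) ∧
    (∀ y, 0 ≤ (1 / ℓ) * S.indicator (fun _ ↦ (1 : ℝ)) y) ∧
    (∀ y, (1 / ℓ) * S.indicator (fun _ ↦ (1 : ℝ)) y ≤ 1 / ℓ) ∧
    (∀ y, y ∉ Icc (-ε) ε → (1 / ℓ) * S.indicator (fun _ ↦ (1 : ℝ)) y = 0) ∧
    ∫ y, (1 / ℓ) * S.indicator (fun _ ↦ (1 : ℝ)) y = 1 := by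
  refine ⟨(measurable_const.indicator hS).const_mul _, fun y ↦ ?_, fun y ↦ ?_, fun y hy ↦ ?_, ?_⟩
  · by_cases h : y ∈ S
    · rw [indicator_of_mem h]; positivity
    · rw [indicator_of_notMem h, mul_zero]
  · by_cases h : y ∈ S
    · rw [indicator_of_mem h, mul_one]
    · rw [indicator_of_notMem h, mul_zero]; positivity
  · rw [indicator_of_notMem (fun h ↦ hy (hSε h)), mul_zero]
  · rw [integral_const_mul, integral_indicator hS, setIntegral_const, smul_eq_mul, mul_one, hvol]
    field_simp

/-! ## §2 The quadratic modulus of a box average -/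

variable {G : ℝ → ℝ} {CG b : ℝ}

/-- **Box averages have a quadratic modulus.**  For an admissible `G` on `[−b, b]`, `σ > 0`, `0 < h ≤ 2σ`, the box average
`w(x) = ∫ (2σ)⁻¹1_{[−σ,σ]}(y) G(x − y) dy` satisfies `∫ (w(x+h) − w(x))² dx ≤ (h/σ)²·∫G²`. -/
theorem integral_sq_boxSmoothed_shift_sub_le (hG : Measurable G) (hCG : ∀ x, |G x| ≤ CG)
    (hGs : ∀ x, x ∉ Icc (-b) b → G x = 0) {σ h : ℝ} (hσ : 0 < σ) (hh : 0 < h) (hh2 : h ≤ 2 * σ) :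
    ∫ x, ((∫ y, (1 / (2 * σ)) * (Icc (-σ) σ).indicator (fun _ ↦ (1 : ℝ)) y * G (x + h - y))
        - ∫ y, (1 / (2 * σ)) * (Icc (-σ) σ).indicator (fun _ ↦ (1 : ℝ)) y * G (x - y)) ^ 2
      ≤ (h / σ) ^ 2 * ∫ x, G x ^ 2 := by
  -- the two small windows and their averages
  set S₁ : Set ℝ := Ico (-σ - h) (-σ) with hS₁
  set S₂ : Set ℝ := Ioc (σ - h) σ with hS₂
  have hS₁m : MeasurableSet S₁ := measurableSet_Ico
  have hS₂m : MeasurableSet S₂ := measurableSet_Ioc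
  have hS₁ε : S₁ ⊆ Icc (-(σ + h)) (σ + h) := fun y hy ↦ ⟨by rw [hS₁] at hy; linarith [hy.1], by rw [hS₁] at hy; linarith [hy.2]⟩
  have hS₂ε : S₂ ⊆ Icc (-(σ + h)) (σ + h) := fun y hy ↦ ⟨by rw [hS₂] at hy; linarith [hy.1], by rw [hS₂] at hy; linarith [hy.2]⟩
  have hv₁ : volume.real S₁ = h := by rw [hS₁, Real.volume_real_Ico_of_le (by linarith)]; ring
  have hv₂ : volume.real S₂ = h := by rw [hS₂, Real.volume_real_Ioc_of_le (by linarith)]; ring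
  obtain ⟨hψ₁m, hψ₁0, hψ₁C, hψ₁s, hψ₁1⟩ := box_weight hS₁m hS₁ε hh hv₁
  obtain ⟨hψ₂m, hψ₂0, hψ₂C, hψ₂s, hψ₂1⟩ := box_weight hS₂m hS₂ε hh hv₂
  set A₁ : ℝ → ℝ := fun x ↦ ∫ y, (1 / h) * S₁.indicator (fun _ ↦ (1 : ℝ)) y * G (x - y) with hA₁
  set A₂ : ℝ → ℝ := fun x ↦ ∫ y, (1 / h) * S₂.indicator (fun _ ↦ (1 : ℝ)) y * G (x - y) with hA₂
  have hA₁sq : ∫ x, A₁ x ^ 2 ≤ ∫ x, G x ^ 2 := integral_smoothed_sq_le hG hCG hGs hψ₁m hψ₁0 hψ₁C hψ₁s hψ₁1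
  have hA₂sq : ∫ x, A₂ x ^ 2 ≤ ∫ x, G x ^ 2 := integral_smoothed_sq_le hG hCG hGs hψ₂m hψ₂0 hψ₂C hψ₂s hψ₂1
  obtain ⟨hA₁m, hA₁b, hA₁s⟩ := smoothed_admissible hG hCG hGs hψ₁m hψ₁0 hψ₁s hψ₁1
  obtain ⟨hA₂m, hA₂b, hA₂s⟩ := smoothed_admissible hG hCG hGs hψ₂m hψ₂0 hψ₂s hψ₂1
  -- integrability of `k·G(x − ·)` for bounded measurable weights `k` with bounded support
  have hint : ∀ (x : ℝ) {k : ℝ → ℝ} {Ck : ℝ}, Measurable k → (∀ y, |k y| ≤ Ck) →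
      (∀ y, y ∉ Icc (-(σ + h)) (σ + h) → k y = 0) → Integrable fun y ↦ k y * G (x - y) := by
    intro x k Ck hk hCk hks
    have hdom : Integrable ((Icc (-(σ + h)) (σ + h)).indicator fun _ : ℝ ↦ Ck * CG) :=
      (integrable_indicator_iff measurableSet_Icc).2 (integrableOn_const (by simp [Real.volume_Icc]))
    refine hdom.mono' (hk.mul (hG.comp (measurable_const.sub measurable_id))).aestronglyMeasurable
      (Eventually.of_forall fun y ↦ ?_)
    by_cases hy : y ∈ Icc (-(σ + h)) (σ + h)
    · rw [indicator_of_mem hy, Real.norm_eq_abs, abs_mul]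
      exact mul_le_mul (hCk y) (hCG _) (abs_nonneg _) ((abs_nonneg _).trans (hCk 0))
    · rw [indicator_of_notMem hy, hks y hy, zero_mul, norm_zero]
  -- the pointwise identity `w(x+h) − w(x) = (h/2σ)(A₁ x − A₂ x)`
  have hpt : ∀ x, (∫ y, (1 / (2 * σ)) * (Icc (-σ) σ).indicator (fun _ ↦ (1 : ℝ)) y * G (x + h - y))
      - (∫ y, (1 / (2 * σ)) * (Icc (-σ) σ).indicator (fun _ ↦ (1 : ℝ)) y * G (x - y))
      = (h / (2 * σ)) * (A₁ x - A₂ x) := by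
    intro x
    -- translate the first integral: `y ↦ y + h`
    have htr : ∫ y, (1 / (2 * σ)) * (Icc (-σ) σ).indicator (fun _ ↦ (1 : ℝ)) y * G (x + h - y)
        = ∫ y, (1 / (2 * σ)) * (Icc (-σ - h) (σ - h)).indicator (fun _ ↦ (1 : ℝ)) y * G (x - y) := by
      rw [← integral_add_right_eq_self (fun y ↦ (1 / (2 * σ)) * (Icc (-σ) σ).indicator (fun _ ↦ (1 : ℝ)) y * G (x + h - y)) h]
      refine integral_congr_ae (Eventually.of_forall fun y ↦ ?_)
      have e1 : (Icc (-σ) σ).indicator (fun _ ↦ (1 : ℝ)) (y + h) = (Icc (-σ - h) (σ - h)).indicator (fun _ ↦ (1 : ℝ)) y := by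
        by_cases hy : y ∈ Icc (-σ - h) (σ - h)
        · have : y + h ∈ Icc (-σ) σ := ⟨by linarith [hy.1], by linarith [hy.2]⟩
          rw [indicator_of_mem this, indicator_of_mem hy]
        · have : y + h ∉ Icc (-σ) σ := fun h' ↦ hy ⟨by linarith [h'.1], by linarith [h'.2]⟩
          rw [indicator_of_notMem this, indicator_of_notMem hy]
      simp only [e1]
      rw [show x + h - (y + h) = x - y by ring]
    -- integrals of `1_S·G(x − ·)`
    have iS : ∀ (S : Set ℝ), MeasurableSet S → S ⊆ Icc (-(σ + h)) (σ + h) →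
        Integrable fun y ↦ S.indicator (fun _ ↦ (1 : ℝ)) y * G (x - y) := by
      intro S hSm hSs
      refine hint x (measurable_const.indicator hSm) (Ck := 1) (fun y ↦ ?_) (fun y hy ↦ indicator_of_notMem (fun h' ↦ hy (hSs h')) _)
      by_cases hy : y ∈ S
      · rw [indicator_of_mem hy, abs_one]
      · rw [indicator_of_notMem hy, abs_zero]; exact zero_le_one
    have hBε : Icc (-σ - h) (σ - h) ⊆ Icc (-(σ + h)) (σ + h) := fun y hy ↦ ⟨by linarith [hy.1], by linarith [hy.2]⟩
    have hCε : Icc (-σ) σ ⊆ Icc (-(σ + h)) (σ + h) := fun y hy ↦ ⟨by linarith [hy.1], by linarith [hy.2]⟩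
    have hMε : Icc (-σ) (σ - h) ⊆ Icc (-(σ + h)) (σ + h) := fun y hy ↦ ⟨by linarith [hy.1], by linarith [hy.2]⟩
    have hS₁ε' : S₁ ⊆ Icc (-(σ + h)) (σ + h) := hS₁ε
    have hS₂ε' : S₂ ⊆ Icc (-(σ + h)) (σ + h) := hS₂ε
    -- splitting the two big windows at `−σ` and `σ − h`
    have hd1 : Disjoint S₁ (Icc (-σ) (σ - h)) := by
      rw [hS₁]; exact Set.disjoint_left.2 fun y hy hy' ↦ (not_le.2 hy.2) hy'.1
    have hd2 : Disjoint (Icc (-σ) (σ - h)) S₂ := by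
      rw [hS₂]; exact Set.disjoint_left.2 fun y hy hy' ↦ (not_lt.2 hy.2) hy'.1
    have hu1 : S₁ ∪ Icc (-σ) (σ - h) = Icc (-σ - h) (σ - h) := by rw [hS₁]; exact Ico_union_Icc_eq_Icc (by linarith) (by linarith)
    have hu2 : Icc (-σ) (σ - h) ∪ S₂ = Icc (-σ) σ := by rw [hS₂]; exact Icc_union_Ioc_eq_Icc (by linarith) (by linarith)
    have hsplit1 : ∫ y, (Icc (-σ - h) (σ - h)).indicator (fun _ ↦ (1 : ℝ)) y * G (x - y)
        = (∫ y, S₁.indicator (fun _ ↦ (1 : ℝ)) y * G (x - y)) + ∫ y, (Icc (-σ) (σ - h)).indicator (fun _ ↦ (1 : ℝ)) y * G (x - y) := by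
      rw [← integral_add (iS S₁ hS₁m hS₁ε') (iS _ measurableSet_Icc hMε)]
      refine integral_congr_ae (Eventually.of_forall fun y ↦ ?_)
      show (Icc (-σ - h) (σ - h)).indicator (fun _ ↦ (1 : ℝ)) y * G (x - y) = _
      rw [← hu1, indicator_union_of_disjoint hd1]; ring
    have hsplit2 : ∫ y, (Icc (-σ) σ).indicator (fun _ ↦ (1 : ℝ)) y * G (x - y)
        = (∫ y, (Icc (-σ) (σ - h)).indicator (fun _ ↦ (1 : ℝ)) y * G (x - y)) + ∫ y, S₂.indicator (fun _ ↦ (1 : ℝ)) y * G (x - y) := by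
      rw [← integral_add (iS _ measurableSet_Icc hMε) (iS S₂ hS₂m hS₂ε')]
      refine integral_congr_ae (Eventually.of_forall fun y ↦ ?_)
      show (Icc (-σ) σ).indicator (fun _ ↦ (1 : ℝ)) y * G (x - y) = _
      rw [← hu2, indicator_union_of_disjoint hd2]; ring
    -- pull the constants
    have hc1 : ∫ y, (1 / (2 * σ)) * (Icc (-σ - h) (σ - h)).indicator (fun _ ↦ (1 : ℝ)) y * G (x - y)
        = (1 / (2 * σ)) * ∫ y, (Icc (-σ - h) (σ - h)).indicator (fun _ ↦ (1 : ℝ)) y * G (x - y) := by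
      rw [← integral_const_mul]; exact integral_congr_ae (Eventually.of_forall fun y ↦ by ring)
    have hc2 : ∫ y, (1 / (2 * σ)) * (Icc (-σ) σ).indicator (fun _ ↦ (1 : ℝ)) y * G (x - y)
        = (1 / (2 * σ)) * ∫ y, (Icc (-σ) σ).indicator (fun _ ↦ (1 : ℝ)) y * G (x - y) := by
      rw [← integral_const_mul]; exact integral_congr_ae (Eventually.of_forall fun y ↦ by ring)
    have hc3 : A₁ x = (1 / h) * ∫ y, S₁.indicator (fun _ ↦ (1 : ℝ)) y * G (x - y) := by
      simp only [hA₁]; rw [← integral_const_mul]; exact integral_congr_ae (Eventually.of_forall fun y ↦ by ring)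
    have hc4 : A₂ x = (1 / h) * ∫ y, S₂.indicator (fun _ ↦ (1 : ℝ)) y * G (x - y) := by
      simp only [hA₂]; rw [← integral_const_mul]; exact integral_congr_ae (Eventually.of_forall fun y ↦ by ring)
    rw [htr, hc1, hc2, hsplit1, hsplit2, hc3, hc4]
    field_simp
    ring
  -- assemble: `∫(Δw)² = (h/2σ)²∫(A₁ − A₂)² ≤ (h/2σ)²·4∫G²`
  have hzero : Measurable (fun _ : ℝ ↦ (0 : ℝ)) ∧ (∀ y : ℝ, |(0 : ℝ)| ≤ 0) ∧
      (∀ y : ℝ, y ∉ Icc (-(b + (σ + h))) (b + (σ + h)) → (0 : ℝ) = 0) :=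
    ⟨measurable_const, fun _ ↦ by simp, fun _ _ ↦ rfl⟩
  have hdiff := integral_sq_sub_le_two_mul_add (B := b + (σ + h)) hA₁m hA₂m hzero.1 hA₁b hA₂b hzero.2.1 hA₁s hA₂s hzero.2.2
  simp only [sub_zero, zero_sub, even_two, Even.neg_pow] at hdiff
  have e : (fun x ↦ ((∫ y, (1 / (2 * σ)) * (Icc (-σ) σ).indicator (fun _ ↦ (1 : ℝ)) y * G (x + h - y))
        - ∫ y, (1 / (2 * σ)) * (Icc (-σ) σ).indicator (fun _ ↦ (1 : ℝ)) y * G (x - y)) ^ 2)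
      = fun x ↦ (h / (2 * σ)) ^ 2 * (A₁ x - A₂ x) ^ 2 := by
    funext x; rw [hpt x]; ring
  rw [e, integral_const_mul]
  have hG0 : 0 ≤ ∫ x, G x ^ 2 := integral_nonneg fun x ↦ sq_nonneg _
  have h4 : ∫ x, (A₁ x - A₂ x) ^ 2 ≤ 4 * ∫ x, G x ^ 2 := by linarith [hdiff, hA₁sq, hA₂sq]
  have hc0 : 0 ≤ (h / (2 * σ)) ^ 2 := sq_nonneg _
  calc (h / (2 * σ)) ^ 2 * ∫ x, (A₁ x - A₂ x) ^ 2 ≤ (h / (2 * σ)) ^ 2 * (4 * ∫ x, G x ^ 2) :=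
        mul_le_mul_of_nonneg_left h4 hc0
    _ = (h / σ) ^ 2 * ∫ x, G x ^ 2 := by field_simp; ring

/-! ## §3 The smoothed residual -/

/-- ★ **A smooth test direction close to the truncated residual, with a quadratic modulus.**  For `0 < σ`, any real `R`,
with `r̃ = 1_{[−(a−2σ), a−2σ]}·(T_aC_a − R·C_a)`: there is a real Weil test `v` supported in `[−a, a]`, admissible with
`|v| ≤ (2A + |R|)cosh(a/2)`, `∫v² ≤ ∫r̃²`, `∫(v(x+h) − v(x))² ≤ (h/σ)²∫r̃²` for `0 < h ≤ 2σ`, and `∫(v − r̃)² ≤ 4δ` whenever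
`∫(r̃(x−y) − r̃(x))² ≤ δ` for all `y ∈ [−σ, σ]` (box average of half-width `σ`, then the bump of scale `σ`). -/
theorem exists_smoothedResidual {a σ : ℝ} (hσ : 0 < σ) (R : ℝ) :
    ∃ v : ℝ → ℝ, IsWeilTest (fun x ↦ (v x : ℂ)) ∧ tsupport (fun x ↦ (v x : ℂ)) ⊆ Icc (-a) a ∧ Measurable v ∧
      (∀ x, |v x| ≤ (2 * (∑ n ∈ weilPrimeIndex a, (Λ n : ℝ) / Real.sqrt n) + |R|) * Real.cosh (a / 2)) ∧
      (∀ x, x ∉ Icc (-a) a → v x = 0) ∧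
      (∫ x, v x ^ 2 ≤ ∫ x, ((Icc (-(a - 2 * σ)) (a - 2 * σ)).indicator (fun x ↦
        (∑ n ∈ weilPrimeIndex a, (Λ n : ℝ) / Real.sqrt n *
          ((Icc (-a) a).indicator (fun y ↦ Real.cosh (y / 2)) (x - Real.log n)
            + (Icc (-a) a).indicator (fun y ↦ Real.cosh (y / 2)) (x + Real.log n)))
        - R * (Icc (-a) a).indicator (fun y ↦ Real.cosh (y / 2)) x) x) ^ 2) ∧
      (∀ h : ℝ, 0 < h → h ≤ 2 * σ → ∫ x, (v (x + h) - v x) ^ 2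
        ≤ (h / σ) ^ 2 * ∫ x, ((Icc (-(a - 2 * σ)) (a - 2 * σ)).indicator (fun x ↦
          (∑ n ∈ weilPrimeIndex a, (Λ n : ℝ) / Real.sqrt n *
            ((Icc (-a) a).indicator (fun y ↦ Real.cosh (y / 2)) (x - Real.log n)
              + (Icc (-a) a).indicator (fun y ↦ Real.cosh (y / 2)) (x + Real.log n)))
          - R * (Icc (-a) a).indicator (fun y ↦ Real.cosh (y / 2)) x) x) ^ 2) ∧
      (∀ δ : ℝ, (∀ y ∈ Icc (-σ) σ, ∫ x, ((Icc (-(a - 2 * σ)) (a - 2 * σ)).indicator (fun x ↦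
          (∑ n ∈ weilPrimeIndex a, (Λ n : ℝ) / Real.sqrt n *
            ((Icc (-a) a).indicator (fun y ↦ Real.cosh (y / 2)) (x - Real.log n)
              + (Icc (-a) a).indicator (fun y ↦ Real.cosh (y / 2)) (x + Real.log n)))
          - R * (Icc (-a) a).indicator (fun y ↦ Real.cosh (y / 2)) x) (x - y)
        - (Icc (-(a - 2 * σ)) (a - 2 * σ)).indicator (fun x ↦
          (∑ n ∈ weilPrimeIndex a, (Λ n : ℝ) / Real.sqrt n *
            ((Icc (-a) a).indicator (fun y ↦ Real.cosh (y / 2)) (x - Real.log n)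
              + (Icc (-a) a).indicator (fun y ↦ Real.cosh (y / 2)) (x + Real.log n)))
          - R * (Icc (-a) a).indicator (fun y ↦ Real.cosh (y / 2)) x) x) ^ 2 ≤ δ) →
        ∫ x, (v x - (Icc (-(a - 2 * σ)) (a - 2 * σ)).indicator (fun x ↦
          (∑ n ∈ weilPrimeIndex a, (Λ n : ℝ) / Real.sqrt n *
            ((Icc (-a) a).indicator (fun y ↦ Real.cosh (y / 2)) (x - Real.log n)
              + (Icc (-a) a).indicator (fun y ↦ Real.cosh (y / 2)) (x + Real.log n)))
          - R * (Icc (-a) a).indicator (fun y ↦ Real.cosh (y / 2)) x) x) ^ 2 ≤ 4 * δ) := by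
  set c := a - 2 * σ with hc
  have hca : c ≤ a := by rw [hc]; linarith
  obtain ⟨hrm, hrb, hrs, -⟩ := residual_trunc_admissible (a := a) hca R
  -- name the truncated residual
  generalize hr : (Icc (-c) c).indicator (fun x ↦
      (∑ n ∈ weilPrimeIndex a, (Λ n : ℝ) / Real.sqrt n *
        ((Icc (-a) a).indicator (fun y ↦ Real.cosh (y / 2)) (x - Real.log n)
          + (Icc (-a) a).indicator (fun y ↦ Real.cosh (y / 2)) (x + Real.log n)))
      - R * (Icc (-a) a).indicator (fun y ↦ Real.cosh (y / 2)) x) = r at hrm hrb hrs ⊢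
  set M₀ := (2 * (∑ n ∈ weilPrimeIndex a, (Λ n : ℝ) / Real.sqrt n) + |R|) * Real.cosh (a / 2) with hM₀
  -- stage 1: the box average `w`
  have hvol : volume.real (Icc (-σ) σ) = 2 * σ := by rw [Real.volume_real_Icc_of_le (by linarith)]; ring
  obtain ⟨hψm, hψ0, hψC, hψs, hψ1⟩ := box_weight (S := Icc (-σ) σ) measurableSet_Icc Subset.rfl (by linarith : 0 < 2 * σ) hvol
  set w : ℝ → ℝ := fun x ↦ ∫ y, (1 / (2 * σ)) * (Icc (-σ) σ).indicator (fun _ ↦ (1 : ℝ)) y * r (x - y) with hw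
  obtain ⟨hwm, hwb, hws⟩ := smoothed_admissible hrm hrb hrs hψm hψ0 hψs hψ1
  have hwN : ∫ x, w x ^ 2 ≤ ∫ x, r x ^ 2 := integral_smoothed_sq_le hrm hrb hrs hψm hψ0 hψC hψs hψ1
  have hwD : ∀ s, ∫ x, (w (x + s) - w x) ^ 2 ≤ ∫ x, (r (x + s) - r x) ^ 2 := fun s ↦
    integral_sq_smoothed_sub_smoothed_le hrm hrb hrs hψm hψ0 hψC hψs hψ1 s
  have hwQ : ∀ h : ℝ, 0 < h → h ≤ 2 * σ → ∫ x, (w (x + h) - w x) ^ 2 ≤ (h / σ) ^ 2 * ∫ x, r x ^ 2 := fun h hh hh2 ↦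
    integral_sq_boxSmoothed_shift_sub_le hrm hrb hrs hσ hh hh2
  -- stage 2: the bump average `v`
  obtain ⟨hφm, hφ0, hφC, hφs, hφ1⟩ := bump_weight hσ
  set v : ℝ → ℝ := fun x ↦ ∫ y, (⟨σ / 2, σ, by positivity, by linarith⟩ : ContDiffBump (0 : ℝ)).normed volume y
    * w (x - y) with hv
  obtain ⟨hvm, hvb, hvs⟩ := smoothed_admissible hwm hwb hws hφm hφ0 hφs hφ1
  have hvW : IsWeilTest fun x ↦ (v x : ℂ) := isWeilTest_smoothed hσ hwm hwb hws
  have hvT : tsupport (fun x ↦ (v x : ℂ)) ⊆ Icc (-a) a := by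
    have h := tsupport_smoothed_subset hσ hwm hwb hws
    have e : c + σ + σ = a := by rw [hc]; ring
    rw [e] at h; exact h
  have hvs' : ∀ x, x ∉ Icc (-a) a → v x = 0 := by
    intro x hx; have e : c + σ + σ = a := by rw [hc]; ring
    exact hvs x (by rw [e]; exact hx)
  have hvN : ∫ x, v x ^ 2 ≤ ∫ x, w x ^ 2 := integral_smoothed_sq_le hwm hwb hws hφm hφ0 hφC hφs hφ1
  have hvD : ∀ s, ∫ x, (v (x + s) - v x) ^ 2 ≤ ∫ x, (w (x + s) - w x) ^ 2 := fun s ↦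
    integral_sq_smoothed_sub_smoothed_le hwm hwb hws hφm hφ0 hφC hφs hφ1 s
  refine ⟨v, hvW, hvT, hvm, hvb, hvs', hvN.trans hwN, fun h hh hh2 ↦ (hvD h).trans (hwQ h hh hh2), fun δ hδ ↦ ?_⟩
  -- closeness: `‖v − w‖² ≤ δ`, `‖w − r‖² ≤ δ`
  have hwr : ∫ x, (w x - r x) ^ 2 ≤ δ := integral_sq_smoothed_sub_le hrm hrb hrs hψm hψ0 hψC hψs hψ1 hδ
  have hvw : ∫ x, (v x - w x) ^ 2 ≤ δ := by
    refine integral_sq_smoothed_sub_le hwm hwb hws hφm hφ0 hφC hφs hφ1 fun y hy ↦ ?_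
    have e : ∫ x, (w (x - y) - w x) ^ 2 = ∫ x, (w (x + -y) - w x) ^ 2 := by simp only [← sub_eq_add_neg]
    rw [e]
    refine (hwD (-y)).trans ?_
    have e2 : ∫ x, (r (x + -y) - r x) ^ 2 = ∫ x, (r (x - y) - r x) ^ 2 := by simp only [← sub_eq_add_neg]
    rw [e2]; exact hδ y hy
  have hB : ∀ x, x ∉ Icc (-a) a → w x = 0 := fun x hx ↦ hws x fun hm ↦ hx ⟨by rw [hc] at hm; linarith [hm.1], by rw [hc] at hm; linarith [hm.2]⟩
  have hrB : ∀ x, x ∉ Icc (-a) a → r x = 0 := fun x hx ↦ hrs x fun hm ↦ hx ⟨by rw [hc] at hm; linarith [hm.1], by rw [hc] at hm; linarith [hm.2]⟩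
  have h3 := integral_sq_sub_le_two_mul_add (B := a) hvm hrm hwm hvb hrb hwb hvs' hrB hB
  linarith [h3, hvw, hwr]

end FloorSecondOrder

end Summit.RiemannHypothesis.RiemannHypothesis.Theorems.WeilFormatC
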